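import Summits.CriticalPhenomena.PercolationContinuityZ3.Theorems.Transplant.SiteThmASocketLtOneZd
import HarnessLib

/-!
# SITE percolation on `ℤ^d`: the same-`p` witness AT DENSITY ONE — the socket `SiteSamePWitnessZd d` is equivalent to its
# restriction below one (lane `prim-bschramm`, class C1a, seat p1 gen 4)

builds on p205010 (kernel theorem, internal audit signed; external expert review pending).

The V18 socket `SiteSameP.SiteSamePWitnessZd d` (`Transplant/SiteThmASocketZd.lean`) asks for a lawful bounded-range
history-driven scheme on the star `⊤ ⊇ K_{1,ℤ^d}` at EVERY density `p` with `θ^{site}_0(p) > 0`, including `p = 1`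
(`θ^{site}(1) = 1`), where Kozma–Nitzan's construction (site Lemmas 10–12, finite energy) is not available; the site KN chain
therefore targets the restricted socket `SiteSamePWitnessLtOneZd d` (`Transplant/SiteThmASocketLtOneZd.lean`).  This file supplies
the missing density by the TRIVIAL SINGLE-VERTEX SCHEME: the macro-vertex `v ∈ ℤ²` stands for the lattice vertex
`ι v = (v₀, v₁, 0, …, 0) ∈ ℤ^d` (`2 ≤ d`); the examination of `v` (from an occupied neighbour) reveals the one star coordinate of
`ι v` and succeeds iff that vertex is open.  It is lawful on `⊤` at `(p, ε = 1 - p)` for EVERY `p` (a probe fails exactly when one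
fresh vertex is closed), its envelopes have at most one edge, `U₀ = {star edge of 0}`, and on `{0 open}` the occupied macro-cluster
is carried by `ι` into the open site cluster of `0` — so an infinite final macro-cluster forces `0 ↔^{site} ∞` surely.  At `p = 1`
(indeed whenever `1 - p < 2⁻³²`) this is a witness in the exact shape of the socket.

* `planarEmb d` — the embedding `ι : ℤ² → ℤ^d`; `oneScheme hd` — the single-vertex scheme; `oneScheme_lawful` — lawful at `(p, 1-p)`;
* `starRead_mem_sitePercolatesAt_of_infinite` — `{U₀ open} ∩ {occFinal infinite} ⊆ {0 ↔^{site} ∞}`;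
* `siteSamePWitnessZd_clause_of_near_one` — the socket's clause at every `p` with `1 - p < 2⁻³²`;
* **`siteSamePWitnessZd_of_ltOne (hd : 2 ≤ d) : SiteSamePWitnessLtOneZd d → SiteSamePWitnessZd d`** and
  `siteSamePWitnessZd_iff_ltOne` — the two sockets are equivalent for `d ≥ 2`.
Helper file (`--supports stmt-CriticalPhenomena-4575`); plain definitions + proofs, no sorries, no named-fact hypotheses.
[cite: KozmaNitzan2024, §4 p. 25 (Definition of an exploration process, (1)–(5))] [cite: GrimmettPercolation1999, §1.6 p. 24]
-/

noncomputable section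

namespace Summit.CriticalPhenomena.PercolationContinuityZ3.Theorems.Transplant

namespace SiteSameP

open MeasureTheory Literature.Probability.Percolation Literature.Probability.LatticeModels
open Literature.Probability.Percolation.GadgetSystem (tgt)
open SiteStar HSiteScheme ProbeHistory

variable {d : ℕ}

/-! ## The planar embedding of the macro-lattice -/

/-- The embedding `ι : ℤ² → ℤ^d`, `(x₀, x₁) ↦ (x₀, x₁, 0, …, 0)` (meaningful for `2 ≤ d`). [folklore] -/
def planarEmb (d : ℕ) (x : Site 2) : Site d :=
  fun i => if (i : ℕ) = 0 then x 0 else if (i : ℕ) = 1 then x 1 else 0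

/-- `ι 0 = 0`. [folklore] -/
@[simp] theorem planarEmb_zero (d : ℕ) : planarEmb d 0 = 0 := by
  funext i; simp [planarEmb]

/-- `ι` is additive. [folklore] -/
theorem planarEmb_add (d : ℕ) (x y : Site 2) : planarEmb d (x + y) = planarEmb d x + planarEmb d y := by
  funext i; simp only [planarEmb, Pi.add_apply]; split_ifs <;> simp

/-- `ι` commutes with negation. [folklore] -/
theorem planarEmb_neg (d : ℕ) (x : Site 2) : planarEmb d (-x) = -planarEmb d x := by
  funext i; simp only [planarEmb, Pi.neg_apply]; split_ifs <;> simp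

/-- `ι` carries the unit vector `e_j` of `ℤ²` to the unit vector `e_j` of `ℤ^d` (`2 ≤ d`). [folklore] -/
theorem planarEmb_single (hd : 2 ≤ d) (j : Fin 2) (c : ℤ) :
    planarEmb d (Pi.single j c) = Pi.single (Fin.castLE hd j) c := by
  funext i
  by_cases hij : i = Fin.castLE hd j
  · subst hij
    rw [Pi.single_eq_same]
    fin_cases j <;> simp [planarEmb]
  · rw [Pi.single_eq_of_ne hij]
    have hk : ∀ k : Fin 2, (i : ℕ) = k → (Pi.single j c : Site 2) k = 0 := by
      intro k hk
      rw [Pi.single_apply, if_neg]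
      rintro rfl
      exact hij (Fin.ext (by rw [Fin.val_castLE]; exact hk))
    simp only [planarEmb]
    split_ifs with h0 h1
    · exact hk 0 (by simpa using h0)
    · exact hk 1 (by simpa using h1)
    · rfl

/-- `ι` carries unit steps to unit steps (`2 ≤ d`). [folklore] -/
theorem planarEmb_stepVec (hd : 2 ≤ d) (a : MDir) :
    planarEmb d (stepVec a) = stepVec (Fin.castLE hd a.1, a.2) := by
  unfold stepVec
  cases a.2
  · simp only [Bool.false_eq_true, ↓reduceIte, planarEmb_neg, planarEmb_single hd]
  · simp only [↓reduceIte, planarEmb_single hd]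

/-- `ι` is injective (`2 ≤ d`). [folklore] -/
theorem planarEmb_injective (hd : 2 ≤ d) : Function.Injective (planarEmb d) := by
  intro x y hxy
  have h0 := congrFun hxy (Fin.castLE hd 0)
  have h1 := congrFun hxy (Fin.castLE hd 1)
  simp only [planarEmb, Fin.val_castLE, Fin.val_zero, ↓reduceIte, Fin.val_one, one_ne_zero] at h0 h1
  funext j
  fin_cases j
  · exact h0
  · exact h1

/-- The source and the target of a directed macro-edge are carried to adjacent vertices of `ℤ^d` (`2 ≤ d`). [folklore] -/
theorem planarEmb_adj_tgt (hd : 2 ≤ d) (e : Site 2 × MDir) :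
    (zdGraph d).Adj (planarEmb d e.1) (planarEmb d (tgt e)) := by
  rw [zdGraph_adj_iff_stepVec]
  exact ⟨(Fin.castLE hd e.2.1, e.2.2), by rw [tgt, planarEmb_add, planarEmb_stepVec hd]⟩

/-! ## The single-vertex scheme -/

/-- The star coordinate standing for the macro-vertex `v`: the star edge of `ι v`. [folklore] -/
def coordOf (_hd : 2 ≤ d) (v : Site 2) : Sym2 (Option (Site d)) := starEdge (planarEmb d v)

/-- `coordOf` is injective. [folklore] -/
theorem coordOf_injective (hd : 2 ≤ d) : Function.Injective (coordOf hd) :=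
  fun _ _ h => planarEmb_injective hd (starEdge_injective h)

/-- The initial edge set: the star edge of the origin (`{0 open}` is the initial event; KN's (5)). [folklore] -/
def oneU₀ (d : ℕ) : Finset (Sym2 (Option (Site d))) := {starEdge (0 : Site d)}

/-- The envelope of the examination along `e` after history `h`: the star coordinate of the target, unless already revealed
(it never is along a run; the subtraction makes freshness hold after EVERY history). [folklore] -/
def oneEnv (hd : 2 ≤ d) (h : ProbeHistory (Option (Site d))) (e : Site 2 × MDir) : Finset (Sym2 (Option (Site d))) :=
  {coordOf hd (tgt e)} \ (oneU₀ d ∪ supp h)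

/-- Success of the examination: every examined coordinate is observed open (KN's (4) with `ε = 1 - p`). [folklore] -/
def oneSucc (hd : 2 ≤ d) (h : ProbeHistory (Option (Site d))) (e : Site 2 × MDir) (o : Finset (Sym2 (Option (Site d)))) : Prop :=
  oneEnv hd h e ⊆ o

/-- The next probe: the static examination of the chosen candidate, whenever there is one (KN's (3)). [folklore] -/
def oneNext (hd : 2 ≤ d) (h : ProbeHistory (Option (Site d))) : Option (AProbe (Option (Site d))) :=
  match (mstOf (oneSucc hd) h).choice with
  | none => none
  | some e => some (AProbe.ofStatic (oneEnv hd h e))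

/-- **The single-vertex exploration scheme** on the star over `ℤ^d` (an exploration process in the sense of KN §4 p. 25, with cells
= single vertices). [folklore] -/
def oneScheme (hd : 2 ≤ d) : HSiteScheme (Option (Site d)) := ⟨⟨oneNext hd⟩, oneU₀ d, oneSucc hd⟩

/-- The envelope has at most the one coordinate of the target. [folklore] -/
theorem oneEnv_subset (hd : 2 ≤ d) (h : ProbeHistory (Option (Site d))) (e : Site 2 × MDir) :
    oneEnv hd h e ⊆ {coordOf hd (tgt e)} := Finset.sdiff_subset

/-- If a probe is made, it is the static examination of the chosen candidate. [folklore] -/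
theorem oneNext_eq_some {hd : 2 ≤ d} {h : ProbeHistory (Option (Site d))} {P : AProbe (Option (Site d))}
    (hP : (oneScheme hd).E.next h = some P) :
    ∃ e, (mstOf (oneSucc hd) h).choice = some e ∧ P = AProbe.ofStatic (oneEnv hd h e) := by
  change oneNext hd h = some P at hP
  unfold oneNext at hP
  cases hc : (mstOf (oneSucc hd) h).choice with
  | none => rw [hc] at hP; exact absurd hP (by simp)
  | some e => rw [hc] at hP; exact ⟨e, rfl, (Option.some.inj hP).symm⟩

/-- A finite set lies in what a configuration shows of it iff all its members are open. [folklore] -/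
theorem subset_obs_self_iff {V : Type*} (ω : BondConfig V) (D : Finset (Sym2 V)) : D ⊆ obs ω D ↔ ∀ x ∈ D, x ∈ ω :=
  ⟨fun h _ hx => (mem_obs_iff.1 (h hx)).2, fun h x hx => mem_obs_iff.2 ⟨hx, h x hx⟩⟩

/-- **The single-vertex scheme is lawful on the star `⊤` at `(p, 1 - p)`, for every `p`.**
[cite: KozmaNitzan2024, §4 p. 25 (Definition of an exploration process)] -/
theorem oneScheme_lawful (hd : 2 ≤ d) (p : unitInterval) :
    (oneScheme hd).Lawful (⊤ : SimpleGraph (Option (Site d))) p (1 - p) where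
  fresh := by
    intro h P hP
    obtain ⟨e, -, rfl⟩ := oneNext_eq_some hP
    show Disjoint ((oneEnv hd h e : Finset (Sym2 (Option (Site d)))) : Set (Sym2 (Option (Site d))))
        ((oneU₀ d : Finset (Sym2 (Option (Site d)))) : Set (Sym2 (Option (Site d)))) ∧ Disjoint (oneEnv hd h e) (supp h)
    rw [Finset.disjoint_coe]
    exact ⟨Finset.sdiff_disjoint.mono_right Finset.subset_union_left,
      Finset.sdiff_disjoint.mono_right Finset.subset_union_right⟩
  probes := by
    intro ω _ n hc
    change oneNext hd ((oneScheme hd).E.hist n ω) ≠ none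
    unfold oneNext
    cases hc' : (mstOf (oneSucc hd) ((oneScheme hd).E.hist n ω)).choice with
    | none => exact absurd hc' hc
    | some e => simp
  fail := by
    intro h P e hP hc
    obtain ⟨e', hc', rfl⟩ := oneNext_eq_some hP
    have hee : e' = e := by
      change (mstOf (oneSucc hd) h).choice = some e at hc
      rw [hc'] at hc
      exact Option.some.inj hc
    subst hee
    have hsub : {ω : BondConfig (Option (Site d)) |
        ¬(oneScheme hd).succ h e' ((AProbe.ofStatic (oneEnv hd h e')).read ω)} ⊆ {ω | coordOf hd (tgt e') ∉ ω} := by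
      intro ω hω hmem
      apply hω
      change oneEnv hd h e' ⊆ obs ω (oneEnv hd h e')
      rw [subset_obs_self_iff]
      intro x hx
      rw [Finset.mem_singleton.1 (oneEnv_subset hd h e' hx)]
      exact hmem
    have hc_edge : coordOf hd (tgt e') ∈ (⊤ : SimpleGraph (Option (Site d))).edgeSet :=
      starEdge_mem_edgeSet top_adj_none_some _
    calc (bondPercolation ⊤ p).real {ω | ¬(oneScheme hd).succ h e' ((AProbe.ofStatic (oneEnv hd h e')).read ω)}
        ≤ (bondPercolation ⊤ p).real {ω | coordOf hd (tgt e') ∉ ω} := measureReal_mono hsub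
      _ = 1 - p := by
        have hcpl : {ω : BondConfig (Option (Site d)) | coordOf hd (tgt e') ∉ ω} = {ω | coordOf hd (tgt e') ∈ ω}ᶜ := rfl
        rw [hcpl, measureReal_compl (measurableSet_mem _), probReal_univ, bondPercolation_cylinder ⊤ p hc_edge]

/-- Every envelope has at most one edge. [folklore] -/
theorem card_env_le_one (hd : 2 ≤ d) (h : ProbeHistory (Option (Site d))) (P : AProbe (Option (Site d)))
    (hP : (oneScheme hd).E.next h = some P) : P.env.card ≤ 1 := by
  obtain ⟨e, -, rfl⟩ := oneNext_eq_some hP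
  calc (AProbe.ofStatic (oneEnv hd h e)).env.card = (oneEnv hd h e).card := rfl
    _ ≤ ({coordOf hd (tgt e)} : Finset _).card := Finset.card_le_card (oneEnv_subset hd h e)
    _ = 1 := Finset.card_singleton _

/-- `U₀ ⊆ E(⊤)`. [folklore] -/
theorem oneU₀_subset_edgeSet (d : ℕ) :
    (↑(oneU₀ d) : Set (Sym2 (Option (Site d)))) ⊆ (⊤ : SimpleGraph (Option (Site d))).edgeSet := by
  intro x hx
  rw [oneU₀, Finset.coe_singleton, Set.mem_singleton_iff] at hx
  subst hx
  exact starEdge_mem_edgeSet top_adj_none_some _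

/-! ## The run: occupied macro-vertices are open lattice vertices joined to the origin -/

/-- **The run invariant** on `{0 open}`: every occupied macro-vertex is carried by `ι` into the open site cluster of `0`, and
every edge revealed so far is the coordinate of a determined macro-vertex other than the origin. [folklore] -/
theorem run_inv (hd : 2 ≤ d) {ω : BondConfig (Option (Site d))} (hω : ω ∈ (oneScheme hd).initEvent) : ∀ n : ℕ,
    (∀ v ∈ ((oneScheme hd).stN n ω).occ, planarEmb d v ∈ siteCluster (zdGraph d) (starRead ω) (0 : Site d)) ∧
    (∀ c ∈ supp ((oneScheme hd).E.hist n ω), ∃ v, ((oneScheme hd).stN n ω).Det v ∧ v ≠ 0 ∧ c = coordOf hd v) := by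
  intro n
  induction n with
  | zero =>
    have h0 : (0 : Site d) ∈ starRead ω := by
      rw [mem_starRead]
      exact hω (by simp [oneScheme, oneU₀])
    refine ⟨fun v hv => ?_, fun c hc => ?_⟩
    · have hv0 : v = 0 := by simpa [HSiteScheme.stN, HSiteScheme.mst, HState.start] using hv
      subst hv0
      rw [planarEmb_zero, mem_siteCluster_self_iff]
      exact h0
    · simp at hc
  | succ n ih =>
    obtain ⟨ih1, ih2⟩ := ih
    set S := oneScheme hd with hS
    cases hD : S.E.next (S.E.hist n ω) with
    | none =>
      rw [S.stN_succ_of_next_none hD, AExplorer.hist_succ, S.E.step_of_none hD, supp_cons_none]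
      exact ⟨ih1, ih2⟩
    | some P =>
      obtain ⟨e, hc, hPe⟩ := oneNext_eq_some hD
      have hc' : (S.stN n ω).choice = some e := hc
      obtain ⟨he1, he2⟩ := HState.cand_of_choice hc'
      have hI := S.inv_mst (S.E.hist n ω)
      -- the target is not the origin and its coordinate is fresh
      have ht0 : tgt e ≠ 0 := fun h0 => he2 (Or.inl (h0 ▸ hI.zero_mem))
      have hfresh : coordOf hd (tgt e) ∉ oneU₀ d ∪ supp (S.E.hist n ω) := by
        rw [Finset.mem_union, not_or]
        constructor
        · rw [oneU₀, Finset.mem_singleton]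
          intro hq
          apply ht0
          apply coordOf_injective hd
          rw [hq, coordOf, planarEmb_zero]
        · intro hq
          obtain ⟨v, hv, -, hcv⟩ := ih2 _ hq
          exact he2 (coordOf_injective hd hcv ▸ hv)
      have henv : oneEnv hd (S.E.hist n ω) e = {coordOf hd (tgt e)} := by
        rw [oneEnv, Finset.sdiff_eq_self_iff_disjoint]
        exact Finset.disjoint_singleton_left.2 hfresh
      have hsucc : S.succ (S.E.hist n ω) e (P.read ω) ↔ planarEmb d (tgt e) ∈ starRead ω := by
        rw [hPe, AProbe.read_ofStatic, mem_starRead]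
        change oneEnv hd (S.E.hist n ω) e ⊆ obs ω (oneEnv hd (S.E.hist n ω) e) ↔ _
        rw [subset_obs_self_iff, henv]
        simp [coordOf]
      have hst : S.stN (n + 1) ω = (S.stN n ω).update e (S.succ (S.E.hist n ω) e (P.read ω)) := by
        rw [S.stN_succ_of_next_some hD, hc']
      have hsupp : ∀ c ∈ supp (S.E.hist (n + 1) ω), c = coordOf hd (tgt e) ∨ c ∈ supp (S.E.hist n ω) := by
        intro c hcs
        rw [AExplorer.hist_succ, S.E.step_of_some hD] at hcs
        obtain ⟨r, hr, hcr⟩ := mem_supp_iff.1 hcs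
        rcases List.mem_cons.1 hr with hr | hr
        · left
          have hr' : r = P.record ω := Option.some.inj hr
          have hrec : (P.record ω).1 = P.reveal ω := rfl
          rw [hr', hrec, hPe, AProbe.reveal_ofStatic, henv, Finset.mem_singleton] at hcr
          exact hcr
        · exact Or.inr (mem_supp_iff.2 ⟨r, hr, hcr⟩)
      refine ⟨fun v hv => ?_, fun c hcs => ?_⟩
      · rw [hst] at hv
        by_cases hok : S.succ (S.E.hist n ω) e (P.read ω)
        · rw [(S.stN n ω).update_of_ok e _ hok] at hv
          rcases Finset.mem_insert.1 hv with rfl | hv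
          · have hopen : planarEmb d (tgt e) ∈ starRead ω := hsucc.1 hok
            obtain ⟨h0, hsrc, hreach⟩ := ih1 _ he1
            refine ⟨h0, hopen, hreach.trans (SimpleGraph.Adj.reachable ?_)⟩
            rw [siteOpenGraph_adj]
            exact ⟨planarEmb_adj_tgt hd e, hsrc, hopen⟩
          · exact ih1 v hv
        · rw [(S.stN n ω).update_of_not_ok e _ hok] at hv
          exact ih1 v hv
      · rw [hst]
        rcases hsupp c hcs with rfl | hcs
        · exact ⟨tgt e, (S.stN n ω).det_update_tgt e _, ht0, rfl⟩
        · obtain ⟨v, hv, hv0, rfl⟩ := ih2 _ hcs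
          exact ⟨v, (S.stN n ω).det_update_of_det e _ hv, hv0, rfl⟩

/-- **An infinite final macro-cluster forces `0 ↔^{site} ∞`** (surely, on `{0 open}`): the occupied macro-vertices are carried
injectively into the open site cluster of the origin. [cite: KozmaNitzan2024, §4 p. 25] -/
theorem starRead_mem_sitePercolatesAt_of_infinite (hd : 2 ≤ d) {ω : BondConfig (Option (Site d))}
    (hω : ω ∈ (oneScheme hd).initEvent) (hinf : ((oneScheme hd).occFinal ω).Infinite) :
    starRead ω ∈ sitePercolatesAt (zdGraph d) (0 : Site d) := by
  change (siteCluster (zdGraph d) (starRead ω) 0).Infinite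
  have hsub : planarEmb d '' (oneScheme hd).occFinal ω ⊆ siteCluster (zdGraph d) (starRead ω) 0 := by
    rintro _ ⟨v, hv, rfl⟩
    obtain ⟨n, hn⟩ := Set.mem_iUnion.1 hv
    exact (run_inv hd hω n).1 v hn
  exact ((hinf.image (planarEmb_injective hd).injOn).mono hsub)

/-! ## The socket at density one -/

/-- **The socket's clause at every density `p` with `1 - p < 2⁻³²`** (in particular at `p = 1`), witnessed by the single-vertex
scheme. [cite: KozmaNitzan2024, §4 p. 25 (Definition of an exploration process)] -/
theorem siteSamePWitnessZd_clause_of_near_one (hd : 2 ≤ d) (p : unitInterval) (hp : 1 - (p : ℝ) < (1 / 2) ^ 32) :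
    ∃ (S : HSiteScheme (Option (Site d))) (ε : ℝ) (N : ℕ), S.Lawful (⊤ : SimpleGraph (Option (Site d))) p ε ∧ ε < (1 / 2) ^ 32 ∧
      (∀ hh P, S.E.next hh = some P → P.env.card ≤ N) ∧
      (↑S.U₀ : Set (Sym2 (Option (Site d)))) ⊆ (⊤ : SimpleGraph (Option (Site d))).edgeSet ∧
      S.initEvent ∩ {ω | (S.occFinal ω).Infinite} ⊆
        starRead ⁻¹' sitePercolatesAt (zdGraph d) (0 : Site d) ∪ {ω | ¬ω ⊆ (⊤ : SimpleGraph (Option (Site d))).edgeSet} :=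
  ⟨oneScheme hd, 1 - p, 1, oneScheme_lawful hd p, hp, card_env_le_one hd, oneU₀_subset_edgeSet d,
    fun _ hω => Or.inl (starRead_mem_sitePercolatesAt_of_infinite hd hω.1 hω.2)⟩

/-- **The restricted socket implies the full socket** (`d ≥ 2`): below one use the given witness, at one the single-vertex scheme.
[cite: KozmaNitzan2024, §4 p. 25] -/
theorem siteSamePWitnessZd_of_ltOne (hd : 2 ≤ d) (h : SiteSamePWitnessLtOneZd d) : SiteSamePWitnessZd d := by
  intro p hθ
  rcases p.2.2.lt_or_eq with hp1 | hp1
  · exact h p hp1 hθ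
  · exact siteSamePWitnessZd_clause_of_near_one hd p (by rw [hp1]; norm_num)

/-- **The two sockets are equivalent** for `d ≥ 2`. [folklore] -/
theorem siteSamePWitnessZd_iff_ltOne (hd : 2 ≤ d) : SiteSamePWitnessZd d ↔ SiteSamePWitnessLtOneZd d :=
  ⟨siteSamePWitnessLtOneZd_of_siteSamePWitnessZd d, siteSamePWitnessZd_of_ltOne hd⟩

end SiteSameP

end Summit.CriticalPhenomena.PercolationContinuityZ3.Theorems.Transplant

end
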